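import Summits.HubbardSuperconductivity.HubbardSuperconductivity.Theorems.AnisotropyChordTransferFibre3DiagonalValues

/-!
# Route `AnisotropyChord` / H0 rotor rung: the ℤ² kernel on the NEAR-PAIR WINDOW `|r|∞ ≤ 5` in closed form (`ℚ + ℚ/π`)

The near-pair HOLE₂ skeletons (`…Fibre3TwoHoleBSNear.dualCert_threeQuarter_near`, separations `|d|∞ ≤ 3`) read the ℤ² kernel
`a_∞ = aZ2` at the slot differences `r = d + δ`, `|δ|₁ ≤ 2`, i.e. on `0 ≤ y ≤ x ≤ 5`, `x + y ≤ 6` — beyond the `x ≤ 3` table of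
`…Fibre3DiagonalValues.aZ2_eq_aInfKT`.  From the diagonal values (`aZ2_diag`: `a(4,4) = 176/(105π)`, `a(5,5) = 563/(315π)`) and
harmonicity (`aZ2_harmonic`, McCrea–Whipple recursion row by row):
`a(4,0) = 20 − 184/(3π)`, `a(4,1) = 40/π − 49/4`, `a(4,2) = 3 − 118/(15π)`, `a(4,3) = 12/(5π) − 1/4`, `a(4,4) = 176/(105π)`,
`a(5,0) = 401/4 − 940/(3π)`, `a(5,1) = 3323/(15π) − 70`, `a(5,2) = 97/4 − 1118/(15π)`, `a(5,3) = 499/(35π) − 4`, `a(5,4) = 1/4 + 20/(21π)`,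
`a(5,5) = 563/(315π)` (numerically `.4770, .4824, .4960, .5139, .5335, .5129, .5163, .5253, .5382, .5532, .5689`, within `1e−3` of
`(ln|r| + γ + (3/2)ln 2)/(2π)`).  Other signs/orders by `aZ2_swap`, `aZ2_mirror`, `aZ2_mirror_y`.
Prover seat `hubbard-h0-rotor-p1` g25; helper for stmt-HubbardSuperconductivity-19089 (`--supports`).
WHAT THIS IS NOT: nothing here proves superconductivity in the Hubbard model (rotor TARGET as worded stays FALSE, g15);
classical lattice Green's function values serving ONE input (the ℤ² skeleton) of ONE input (HOLE₂) of ONE conditional reduction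
(rung 19089).  Mathlib + tree imports only; no sorry, no axioms.
-/

set_option linter.dupNamespace false
set_option autoImplicit false

noncomputable section

namespace Summit.HubbardSuperconductivity.HubbardSuperconductivity.Theorems.AnisotropyChord.Transfer.Fibre3

namespace Subsample

/-- harmonicity solved for the next value in a row: `a(x+1,y) = 4a(x,y) − a(x−1,y) − a(x,y+1) − a(x,y−1)` off the origin. [folklore] -/
theorem aZ2_next (x y : ℤ) (h : ¬ (x = 0 ∧ y = 0)) :
    aZ2 (x + 1) y = 4 * aZ2 x y - aZ2 (x - 1) y - aZ2 x (y + 1) - aZ2 x (y - 1) := by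
  have hh := aZ2_harmonic x y
  rw [if_neg h, add_zero] at hh
  linarith

/-- `a_∞(4,0) = 20 − 184/(3π)`. [folklore] -/
theorem aZ2_four_zero : aZ2 4 0 = 20 - 184 / (3 * Real.pi) := by
  have h := aZ2_next 3 0 (by norm_num)
  norm_num at h
  rw [h, aZ2_three_zero', aZ2_two_zero', aZ2_mirror_y, aZ2_three_one']
  ring

/-- `a_∞(4,1) = 40/π − 49/4`. [folklore] -/
theorem aZ2_four_one : aZ2 4 1 = 40 / Real.pi - 49 / 4 := by
  have h := aZ2_next 3 1 (by norm_num)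
  norm_num at h
  rw [h, aZ2_three_one', aZ2_two_one', aZ2_three_two', aZ2_three_zero']
  ring

/-- `a_∞(4,2) = 3 − 118/(15π)`. [folklore] -/
theorem aZ2_four_two : aZ2 4 2 = 3 - 118 / (15 * Real.pi) := by
  have h := aZ2_next 3 2 (by norm_num)
  norm_num at h
  rw [h, aZ2_three_two', aZ2_two_two, aZ2_three_three, aZ2_three_one']
  ring

/-- `a_∞(4,3) = 12/(5π) − 1/4` (harmonicity at `(3,3)`). [folklore] -/
theorem aZ2_four_three : aZ2 4 3 = 12 / (5 * Real.pi) - 1 / 4 := by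
  have h := aZ2_next 3 3 (by norm_num)
  norm_num at h
  rw [aZ2_swap 3 2, aZ2_swap 4 3] at h
  have key : aZ2 4 3 = 2 * aZ2 3 3 - aZ2 3 2 := by linarith
  rw [key, aZ2_three_three, aZ2_three_two']
  ring

/-- `a_∞(4,4) = 176/(105π)`. [folklore] -/
theorem aZ2_four_four : aZ2 4 4 = 176 / (105 * Real.pi) := by
  have h := aZ2_diag 4
  rw [Finset.sum_range_succ, Finset.sum_range_succ, Finset.sum_range_succ, Finset.sum_range_one] at h
  norm_num at h
  rw [h]; ring

/-- `a_∞(5,0) = 401/4 − 940/(3π)`. [folklore] -/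
theorem aZ2_five_zero : aZ2 5 0 = 401 / 4 - 940 / (3 * Real.pi) := by
  have h := aZ2_next 4 0 (by norm_num)
  norm_num at h
  rw [h, aZ2_four_zero, aZ2_three_zero', aZ2_mirror_y, aZ2_four_one]
  ring

/-- `a_∞(5,1) = 3323/(15π) − 70`. [folklore] -/
theorem aZ2_five_one : aZ2 5 1 = 3323 / (15 * Real.pi) - 70 := by
  have h := aZ2_next 4 1 (by norm_num)
  norm_num at h
  rw [h, aZ2_four_one, aZ2_three_one', aZ2_four_two, aZ2_four_zero]
  ring

/-- `a_∞(5,2) = 97/4 − 1118/(15π)`. [folklore] -/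
theorem aZ2_five_two : aZ2 5 2 = 97 / 4 - 1118 / (15 * Real.pi) := by
  have h := aZ2_next 4 2 (by norm_num)
  norm_num at h
  rw [h, aZ2_four_two, aZ2_three_two', aZ2_four_three, aZ2_four_one]
  ring

/-- `a_∞(5,3) = 499/(35π) − 4`. [folklore] -/
theorem aZ2_five_three : aZ2 5 3 = 499 / (35 * Real.pi) - 4 := by
  have h := aZ2_next 4 3 (by norm_num)
  norm_num at h
  rw [h, aZ2_four_three, aZ2_three_three, aZ2_four_four, aZ2_four_two]
  ring

/-- `a_∞(5,4) = 1/4 + 20/(21π)` (harmonicity at `(4,4)`). [folklore] -/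
theorem aZ2_five_four : aZ2 5 4 = 1 / 4 + 20 / (21 * Real.pi) := by
  have h := aZ2_next 4 4 (by norm_num)
  norm_num at h
  rw [aZ2_swap 4 3, aZ2_swap 5 4] at h
  have key : aZ2 5 4 = 2 * aZ2 4 4 - aZ2 4 3 := by linarith
  rw [key, aZ2_four_four, aZ2_four_three]
  ring

/-- `a_∞(5,5) = 563/(315π)`. [folklore] -/
theorem aZ2_five_five : aZ2 5 5 = 563 / (315 * Real.pi) := by
  have h := aZ2_diag 5
  rw [Finset.sum_range_succ, Finset.sum_range_succ, Finset.sum_range_succ, Finset.sum_range_succ,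
    Finset.sum_range_one] at h
  norm_num at h
  rw [h]; ring

end Subsample

end Summit.HubbardSuperconductivity.HubbardSuperconductivity.Theorems.AnisotropyChord.Transfer.Fibre3

end
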